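import Mathlib
import Summits.Ventures.PercRepro2.HCov
import Summits.Ventures.PercRepro2.RootLeafUCells
import Summits.Ventures.PercRepro2.RootLeafUAtoms1
import Summits.Ventures.PercRepro2.RootLeafUAtoms2
import Summits.Ventures.PercRepro2.RootLeafUAtoms3
import Summits.Ventures.PercRepro2.RootLeafUTheorem
import Summits.Ventures.PercRepro2.RootLeafUSecond

set_option synthInstance.maxSize 2048

/-!
# (G4-u): the o-side split of the second coefficient, `T2 = T2oL + T2oK` (blind cell PercRepro2,
p4 g5; proofs/P4-G5-STRUCTURE.md §5–§6, S3 (G4-u) (l))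

`Gc` is linear in the o-row, so every coefficient of the root-leaf cubic splits by the side of `o`
in world 1 (`o ∈ L` / `o ∈ K`); the one-root world has `o ∉ C₁`, so the `o ∈ C₁` half of the
second coefficient carries no world-0 o-mass while the `o ∈ C₂` half carries `e0 = P(o ∈ K, c ∉ K)`.
With `α = D·hb + d0·gap`, `β = S·D + d0·Z`, `κ = S(EQb3 + PDb) + hb(EQ3 + Z) − (S − d0)·gap`
(`S = P(Ω)`, homogenised):

  `T2oL = (α + κ)·P(PD, oL) + 2α·P(T, oL) + 2β·P(T, oL, bL) − 2β·P(Q, oL, c ∉ L, bK)`,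
  `T2oK = ℰ·e0 + (κ − α)·P(PD, oK) − 2α·P(T′, oK, b ∉ K) + 2(β − α)·P(T′, oK, bK) − 2β·P(Q, oK, c ∉ K, bL)`,

and **`T2 = T2oL + T2oK`** (`T2_eq_T2oL_add_T2oK`): through `T2_eq_atoms` and two LINEAR identities in
the 35 cells of RootLeafUCells (`EQbo − EQb3o − PDbo` and `EQo − EQ3o` as pattern sums), then `ring`
(formal pre-check mining/p4/g5/half/t2half_check.py, 2,743 monomials).  These are the leaf Bernstein
coefficients of the halves `GcOL`, `GcOK` of HCovOHalf (`T2oL = T2^{oL}`, 200 / 200 exact), and the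
census has **both halves non-negative** (4,800 / 4,800 leaf instances, kit j245975 + local): the
open sign `0 ≤ T2` of (G4-u) splits into the two one-sided signs `0 ≤ T2oL`, `0 ≤ T2oK`
(`T2_nonneg_of_halves`).
-/
namespace Summit.Ventures.PercRepro2

open UnionCluster CovForm

namespace RootLeafU

variable {V : Type*} {E : Type*} [Fintype E] [DecidableEq E] [Fintype V] [DecidableEq V]
  {R : Type*} [Field R] [LinearOrder R] [IsStrictOrderedRing R]

section Halves

variable (p : E → R) (ends : E → Sym2 V) (o a₂ c b u : V)

/-- **The `o ∈ L` half of the second coefficient** (`T2^{oL}`, cleared and homogenised). -/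
noncomputable def T2oL : R :=
  ((prob p (PDEvent ends u a₂ c) * prob p (connEvent ends a₂ b) + prob p (avoidAll ends a₂ {c}) * gap p ends u a₂ b) + (prob p Set.univ * EQb3 p ends u a₂ c b + prob p Set.univ * PDb p ends u a₂ c b + prob p (connEvent ends a₂ b) * EQ3 p ends u a₂ c + prob p (connEvent ends a₂ b) * prob p (avoidAll ends a₂ {u}) - (prob p Set.univ - prob p (avoidAll ends a₂ {c})) * gap p ends u a₂ b)) * prob p (PDEvent ends u a₂ c ∩ connEvent ends u o) + 2 * (prob p (PDEvent ends u a₂ c) * prob p (connEvent ends a₂ b) + prob p (avoidAll ends a₂ {c}) * gap p ends u a₂ b) * prob p (TEvent ends u a₂ c ∩ connEvent ends u o) + 2 * (prob p Set.univ * prob p (PDEvent ends u a₂ c) + prob p (avoidAll ends a₂ {c}) * prob p (avoidAll ends a₂ {u})) * prob p (TEvent ends u a₂ c ∩ (connEvent ends u o ∩ connEvent ends u b)) - 2 * (prob p Set.univ * prob p (PDEvent ends u a₂ c) + prob p (avoidAll ends a₂ {c}) * prob p (avoidAll ends a₂ {u})) * (prob p (PDEvent ends u a₂ c ∩ (connEvent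 ends u o ∩ connEvent ends a₂ b)) + prob p (TEvent ends u a₂ c ∩ (connEvent ends u o ∩ connEvent ends a₂ b)))

/-- **The `o ∈ K` half of the second coefficient** (`T2^{oK}`; carries the world-0 o-mass `e0`). -/
noncomputable def T2oK : R :=
  Ee p ends a₂ c b u * prob p (avoidAll ends a₂ {c} ∩ connEvent ends a₂ o) + ((prob p Set.univ * EQb3 p ends u a₂ c b + prob p Set.univ * PDb p ends u a₂ c b + prob p (connEvent ends a₂ b) * EQ3 p ends u a₂ c + prob p (connEvent ends a₂ b) * prob p (avoidAll ends a₂ {u}) - (prob p Set.univ - prob p (avoidAll ends a₂ {c})) * gap p ends u a₂ b) - (prob p (PDEvent ends u a₂ c) * prob p (connEvent ends a₂ b) + prob p (avoidAll ends a₂ {c}) * gap p ends u a₂ b)) * prob p (PDEvent ends u a₂ c ∩ connEvent ends a₂ o) - 2 * (prob p (PDEvent ends u a₂ c) * prob p (connEvent ends a₂ b) + prob p (avoidAll ends a₂ {c}) * gap p ends u a₂ b) * (prob p (TEvent ends a₂ u c ∩ connEvent ends a₂ o) - prob p (TEvent ends a₂ u c ∩ (connEvent ends a₂ o ∩ connEvent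 ends a₂ b))) + 2 * ((prob p Set.univ * prob p (PDEvent ends u a₂ c) + prob p (avoidAll ends a₂ {c}) * prob p (avoidAll ends a₂ {u})) - (prob p (PDEvent ends u a₂ c) * prob p (connEvent ends a₂ b) + prob p (avoidAll ends a₂ {c}) * gap p ends u a₂ b)) * prob p (TEvent ends a₂ u c ∩ (connEvent ends a₂ o ∩ connEvent ends a₂ b)) - 2 * (prob p Set.univ * prob p (PDEvent ends u a₂ c) + prob p (avoidAll ends a₂ {c}) * prob p (avoidAll ends a₂ {u})) * (prob p (PDEvent ends u a₂ c ∩ (connEvent ends a₂ o ∩ connEvent ends u b)) + prob p (TEvent ends a₂ u c ∩ (connEvent ends a₂ o ∩ connEvent ends u b)))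

omit [LinearOrder R] [IsStrictOrderedRing R] in
/-- `EQbo − EQb3o − PDbo = 2·[P(T,oL,bL) − P(PD,oL,bK) − P(T,oL,bK) + P(T′,oK,bK) − P(PD,oK,bL) − P(T′,oK,bL)]`
(linear in the 35 cells). -/
lemma EQbo_sub_eq :
    EQbo p ends o u a₂ b - EQb3o p ends o u a₂ c b - PDbo p ends o u a₂ c b =
      2 * (prob p (TEvent ends u a₂ c ∩ (connEvent ends u o ∩ connEvent ends u b)) - prob p (PDEvent ends u a₂ c ∩ (connEvent ends u o ∩ connEvent ends a₂ b)) - prob p (TEvent ends u a₂ c ∩ (connEvent ends u o ∩ connEvent ends a₂ b)) + prob p (TEvent ends a₂ u c ∩ (connEvent ends a₂ o ∩ connEvent ends a₂ b)) - prob p (PDEvent ends u a₂ c ∩ (connEvent ends a₂ o ∩ connEvent ends u b)) - prob p (TEvent ends a₂ u c ∩ (connEvent ends a₂ o ∩ connEvent ends u b))) := by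
  unfold EQbo EQb3o PDbo
  rw [cells_Q_uo_ub p ends o a₂ c b u, cells_Q_ao_ab p ends o a₂ c b u, cells_Q_ao_ub p ends o a₂ c b u, cells_Q_uo_ab p ends o a₂ c b u, cells_Tp_uo_ub p ends o a₂ c b u, cells_Tp_ao_ub p ends o a₂ c b u, cells_T_uo_ab p ends o a₂ c b u, cells_T_ao_ab p ends o a₂ c b u, cells_T_uo_ub p ends o a₂ c b u, cells_T_ao_ub p ends o a₂ c b u, cells_Tp_uo_ab p ends o a₂ c b u, cells_Tp_ao_ab p ends o a₂ c b u, cells_PD_uo_ub p ends o a₂ c b u, cells_PD_ao_ub p ends o a₂ c b u, cells_PD_uo_ab p ends o a₂ c b u, cells_PD_ao_ab p ends o a₂ c b u]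
  ring

omit [LinearOrder R] [IsStrictOrderedRing R] in
include b in
/-- `EQo − EQ3o = P(PD,oL) + 2·P(T,oL) − P(PD,oK) − 2·P(T′,oK)` (linear in the 35 cells). -/
lemma EQo_sub_eq :
    EQo p ends o u a₂ - EQ3o p ends o u a₂ c =
      prob p (PDEvent ends u a₂ c ∩ connEvent ends u o) + 2 * prob p (TEvent ends u a₂ c ∩ connEvent ends u o) - prob p (PDEvent ends u a₂ c ∩ connEvent ends a₂ o) - 2 * prob p (TEvent ends a₂ u c ∩ connEvent ends a₂ o) := by
  unfold EQo EQ3o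
  rw [cells_Q_uo p ends o a₂ c b u, cells_Q_ao p ends o a₂ c b u, cells_Tp_uo p ends o a₂ c b u, cells_Tp_ao p ends o a₂ c b u, cells_T_uo p ends o a₂ c b u, cells_T_ao p ends o a₂ c b u, cells_PD_uo p ends o a₂ c b u, cells_PD_ao p ends o a₂ c b u]
  ring

omit [LinearOrder R] [IsStrictOrderedRing R] in
/-- **The o-side split of `T2`**: `T2 = T2oL + T2oK`. -/
theorem T2_eq_T2oL_add_T2oK :
    T2 p ends o a₂ c b u = T2oL p ends o a₂ c b u + T2oK p ends o a₂ c b u := by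
  have h1 := EQbo_sub_eq p ends o a₂ c b u
  have h2 := EQo_sub_eq p ends o a₂ c b u
  rw [T2_eq_atoms]
  unfold T2oL T2oK Cc Hh Dd Ee DEF Do
  linear_combination (prob p Set.univ * prob p (PDEvent ends u a₂ c) + prob p (avoidAll ends a₂ {c}) * prob p (avoidAll ends a₂ {u})) * h1 + (prob p (connEvent ends a₂ b) * prob p (PDEvent ends u a₂ c) + prob p (avoidAll ends a₂ {c}) * gap p ends u a₂ b) * h2

/-- **`0 ≤ T2` from the two one-sided signs**. -/
theorem T2_nonneg_of_halves (hL : 0 ≤ T2oL p ends o a₂ c b u) (hK : 0 ≤ T2oK p ends o a₂ c b u) :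
    0 ≤ T2 p ends o a₂ c b u := by
  rw [T2_eq_T2oL_add_T2oK]
  exact add_nonneg hL hK

end Halves

end RootLeafU

end Summit.Ventures.PercRepro2
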